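import Literature.Geometry.Lorentzian.KlainermanSzeftel2021.SupToFluxExponents

/-!
# Klainerman–Szeftel Lemma 9.4.13: the `u`-count of the near zone `√u ≤ r ≤ u` and the window `2δ_dec < δ_B < 2δ_extra`

CITATION HEADER (lean-in-tree rule 2026-08-18).  Arithmetic of exponents read off

* S. Klainerman, J. Szeftel, *Kerr stability for small angular momentum*, arXiv:2104.11857 (v1, 2021; TeX source
  `Main-Kerr-arxiv.tex`, `KS l.N`) = bib key `KlainermanSzeftel2021` (journal: Pure Appl. Math. Q. **19** (2023) no. 3);
* E. Giorgi, S. Klainerman, J. Szeftel, *Wave equations estimates and the nonlinear stability of slowly rotating Kerr black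
  holes*, arXiv:2205.14808 (TeX source `FinalKerrarxivversion.tex`, `GKS l.N`) = bib key `GiorgiKlainermanSzeftel2022`
  (refereed: Pure Appl. Math. Q. **20** (2024) no. 7, 2865–3849 = bib key `GiorgiKlainermanSzeftel2024`, read in the authors'
  version HAL hal-05348127 — `HAL p. N` below is a page of that text, not a journal page; REFEREE #19 L-6), for the printed
  VALUE `δ_extra = (3δ_dec − 2δ)/2` (GKS l.22524, HAL p. 532) and the printed range "choosing `δ > 0` such that `2δ ≤ δ_dec`" (GKS l.24524).

This module is the companion of `…KlainermanSzeftel2021.SupToFluxExponents` (which it imports and whose `margin`/`wAB`/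
`deltaExtraGKS`/radial lemmas it reuses): that file counts the powers of `r` (the FAR zone `r ≥ u`, radius up to `R ≍ r_*`);
this one counts the powers of `u` in the NEAR zones of the exterior bulk norm
`ᵉˣᵗℜ_k² ⊇ ∫_{ᵉˣᵗ𝓜} r^{3+δ_B} |𝔡^{≤k}B|²` (KS l.23912–23915; the audit cell's reading of the 4-volume: `≍ r² dr du dσ`) for a
component with the two-sided pointwise bound that Theorem M7's decay norm `ᵉˣᵗ𝔇_k` records for `rB ∈ Γ_g` (KS l.5826–5831):
`|𝔡^{≤k}B| ≲ ε₀ min(r^{-2} u^{-1-δ_X}, r^{-3} u^{-1/2-δ_X})` with `δ_X = δ_dec`; the two profiles cross at `r = √u`.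

THE COUNT.
* Zone I (`r₀ ≤ r ≤ √u`, profile `r^{-2}u^{-1-δ_X}`): `r`-integrand `r^{3+δ_B}·r^{-4}·r² = r^{1+δ_B}`, `∫^{√u} = u^{(2+δ_B)/2}/(2+δ_B)`,
  times `u^{-2-2δ_X}`: `u`-exponent `uExpI = δ_B/2 − 1 − 2δ_X`, integrable at `u = ∞` iff `δ_B < 4δ_X` (`uExpI_lt_iff`).
* Zone II (`√u ≤ r ≤ u`, profile `r^{-3}u^{-1/2-δ_X}`): `r`-integrand `r^{3+δ_B}·r^{-6}·r² = r^{-1+δ_B}` (margin `−δ_B`, as in the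
  companion file), `∫_{√u}^{u} ≤ u^{δ_B}/δ_B`, times `u^{-1-2δ_X}`: `u`-exponent `uExpII = δ_B − 1 − 2δ_X`, integrable at `u = ∞`
  iff `δ_B < 2δ_X` (`uExpII_lt_iff`).  With the PRINTED rate `δ_X = δ_dec` and the PRINTED constraint `δ_B > 2δ_dec` (KS (3.4.4),
  l.6076–6081) the exponent is `> −1`: `∫_1^{u_*} u^{uExpII} du → ∞` (`zoneII_printed_unbounded`) — the bulk is finite for every
  `u_*` but NOT bounded uniformly in `u_*` by `ε₀²` from these inputs; with a rate `δ_X` such that `δ_B < 2δ_X` it is, with the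
  explicit bound `1/(2δ_X − δ_B)` (`zoneII_bounded_of_window`).
* The WINDOW.  Theorem M1 item 2 (KS l.6684–6687) gives `A` the near profile `r^{-3}u^{-1/2-δ_extra}`, i.e. `δ_X = δ_extra`; a
  `B`-bound of the same profile is the audit's registry leaf KS9.4.13-Brate (not located in KS/GKS).  The count then closes iff
  `2δ_dec < δ_B < 2δ_extra`; at GKS's value `2δ_extra = 3δ_dec − 2δ` (`two_deltaExtraGKS`) the window is NONEMPTY iff `δ < δ_dec/2`
  (`window_nonempty_iff`), which is STRICTLY inside GKS's printed range `2δ ≤ δ_dec`: at the endpoint `δ = δ_dec/2` it is empty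
  (`window_empty_at_endpoint`; there also `δ_extra = δ_dec`, so GKS's own "`> δ_dec`" needs the strict inequality too,
  `deltaExtraGKS_gt_iff`).  Inside the window zone I closes as well (`uExpI_of_window`).
* The SLICE functional of §9.4.8 (`L_*²(k)`, (9.4.34)–(9.4.35), KS l.24452–24461; registry node KS9.4.8-L0) at `u = u₁ ≤ u_*`:
  zone II+III radial factor `R^{δ_B}/δ_B` with `R = δ_* ε₀^{-1} u_*^{1+δ_dec}` (companion `rstar_pow`) times `u₁^{-1-2δ_dec} ≤ 1`
  gives `ε₀^{2−δ_B} δ_*^{δ_B} u_*^{sliceExp}` with `sliceExp = (1+δ_dec)δ_B − 1 − 2δ_dec < 0` for `δ_B < 1` (`sliceExp_neg`): the slice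
  functional IS bounded uniformly in `u_*` from the printed inputs, with the power loss `ε₀^{2−δ_B}` in place of `ε₀²`.

STATUS.  Census observation of the audit cell `pub-kerr` (GAPS.md K20b′/K20b″ and the lead block K20b‴; registry nodes E-9413,
KS9.4.13-Brate of LEMMAS.md v7), typed as arithmetic over Mathlib and the companion module.  It does not assert that Lemma 9.4.13
is false (size `ε` of `ℜ_{k_small−1}` is a bootstrap assumption, (9.4.20), KS l.24317–24319; the improved profiles exist for `A`);
it records which exponent inequalities the one-sentence step KS l.24420–24425 needs and which of them are printed.  KS and GKS are
refereed publications; nothing here is Final-State-Conjecture progress.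
-/

open Real Set MeasureTheory intervalIntegral Filter

noncomputable section

namespace Literature.Geometry.Lorentzian.KlainermanSzeftel2021.NearZoneCount

open Literature.Geometry.Lorentzian.KlainermanSzeftel2021.SupToFluxExponents

/-! ## §1 The `u`-exponents of zones I and II -/

/-- Zone I (`r ≤ √u`, profile `r^{-2}u^{-1-δ_X}`): `u`-exponent of the bulk integrand after the `r`-integration,
`(2+δ_B)/2 − 2 − 2δ_X = δ_B/2 − 1 − 2δ_X`.  [cite: KlainermanSzeftel2021, decay norm ᵉˣᵗ𝔇_k TeX l.5826–5831 with ᵉˣᵗℜ_k l.23912–23915] -/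
def uExpI (δB δX : ℝ) : ℝ := δB / 2 - 1 - 2 * δX

/-- Zone II (`√u ≤ r ≤ u`, profile `r^{-3}u^{-1/2-δ_X}`): `u`-exponent `δ_B − 1 − 2δ_X`.
[cite: KlainermanSzeftel2021, decay norm ᵉˣᵗ𝔇_k TeX l.5826–5831 with ᵉˣᵗℜ_k l.23912–23915] -/
def uExpII (δB δX : ℝ) : ℝ := δB - 1 - 2 * δX

/-- Bookkeeping of zone I: weight `3+δ_B`, rate `2` squared, area `r²`: `r`-exponent `(3+δ_B) − 4 + 2 = 1 + δ_B`; integrating to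
`√u` gives `u^{(2+δ_B)/2}`; with `u^{-2-2δ_X}` the total is `uExpI`.  [folklore] -/
theorem uExpI_eq (δB δX : ℝ) : ((wAB δB - 2 * 2 + 2) + 1) / 2 + (-2 - 2 * δX) = uExpI δB δX := by
  unfold wAB uExpI; ring

/-- Bookkeeping of zone II: `r`-exponent `(3+δ_B) − 6 + 2 = −1 + δ_B` (= `−1 − margin`, margin `−δ_B` as in the companion file);
integrating gives `u^{δ_B}`; with `u^{-1-2δ_X}` the total is `uExpII`.  [folklore] -/
theorem uExpII_eq (δB δX : ℝ) :
    wAB δB - 2 * 3 + 2 = -1 + δB ∧ margin (wAB δB) 3 = -δB ∧ δB + (-1 - 2 * δX) = uExpII δB δX := by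
  unfold wAB margin uExpII; refine ⟨by ring, by ring, by ring⟩

/-- Zone I is `u`-integrable at infinity (exponent `< −1`) iff `δ_B < 4δ_X`.  [folklore] -/
theorem uExpI_lt_iff (δB δX : ℝ) : uExpI δB δX < -1 ↔ δB < 4 * δX := by
  unfold uExpI; constructor <;> intro h <;> linarith

/-- Zone II is `u`-integrable at infinity (exponent `< −1`) iff `δ_B < 2δ_X` — the upper bound on `δ_B` that the count needs and
that KS (3.4.4) does not print.  [cite: KlainermanSzeftel2021, (3.4.4) TeX l.6076–6081] -/
theorem uExpII_lt_iff (δB δX : ℝ) : uExpII δB δX < -1 ↔ δB < 2 * δX := by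
  unfold uExpII; constructor <;> intro h <;> linarith

/-- With the PRINTED inputs (`δ_X = δ_dec` from Theorem M7's decay norm, `δ_B > 2δ_dec` from (3.4.4)) the zone-II exponent is
`> −1`.  [cite: KlainermanSzeftel2021, (3.4.4) TeX l.6076–6081; ᵉˣᵗ𝔇_k l.5826–5831] -/
theorem uExpII_printed_gt {δB δdec : ℝ} (h344 : 2 * δdec < δB) : -1 < uExpII δB δdec := by
  unfold uExpII; linarith

/-! ## §2 The `u`-integrals: unbounded with the printed rate, bounded inside the window -/

/-- PRINTED inputs: `∫_1^{U} u^{uExpII(δ_B, δ_dec)} du → ∞` as `U → ∞` (exponent `−1 + (δ_B − 2δ_dec)`, `δ_B − 2δ_dec > 0`): the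
`r^{3+δ_B}|B|²` bulk over `ᵉˣᵗ𝓜 ∩ {√u ≤ r ≤ u}` is not bounded uniformly in `u_*` by `ε₀²` from Theorem M7's decay norm.
[cite: KlainermanSzeftel2021, (3.4.4) TeX l.6076–6081; ᵉˣᵗ𝔇_k l.5826–5831; ᵉˣᵗℜ_k l.23912–23915] -/
theorem zoneII_printed_unbounded {δB δdec : ℝ} (h344 : 2 * δdec < δB) :
    Tendsto (fun U : ℝ => ∫ x in (1:ℝ)..U, x ^ uExpII δB δdec) atTop atTop := by
  have h : uExpII δB δdec = -1 + (δB - 2 * δdec) := by unfold uExpII; ring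
  rw [h]
  exact radial_unbounded_of_margin_neg (by linarith) one_pos

/-- INSIDE THE WINDOW (`δ_B < 2δ_X`): `∫_1^{U} u^{uExpII(δ_B, δ_X)} du ≤ 1/(2δ_X − δ_B)` uniformly in `U ≥ 1`.  [folklore] -/
theorem zoneII_bounded_of_window {δB δX U : ℝ} (hw : δB < 2 * δX) (hU : 1 ≤ U) :
    ∫ x in (1:ℝ)..U, x ^ uExpII δB δX ≤ 1 / (2 * δX - δB) := by
  have hm : 0 < 2 * δX - δB := by linarith
  have h : uExpII δB δX = -1 - (2 * δX - δB) := by unfold uExpII; ring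
  rw [h]
  have := radial_bounded_of_margin_pos hm one_pos hU
  simpa [Real.one_rpow] using this

/-- Zone I, printed inputs: `∫_1^{U} u^{uExpI(δ_B, δ_dec)} du ≤ 1/((4δ_dec − δ_B)/2)` whenever `δ_B < 4δ_dec` — NOT decided by (3.4.4)
either (only `δ_B > 2δ_dec` is printed), but implied by the window, next section.  [cite: KlainermanSzeftel2021, (3.4.4) TeX l.6076–6081] -/
theorem zoneI_bounded {δB δdec U : ℝ} (h : δB < 4 * δdec) (hU : 1 ≤ U) :
    ∫ x in (1:ℝ)..U, x ^ uExpI δB δdec ≤ 1 / ((4 * δdec - δB) / 2) := by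
  have hm : 0 < (4 * δdec - δB) / 2 := by linarith
  have h' : uExpI δB δdec = -1 - (4 * δdec - δB) / 2 := by unfold uExpI; ring
  rw [h']
  have := radial_bounded_of_margin_pos hm one_pos hU
  simpa [Real.one_rpow] using this

/-! ## §3 The window `2δ_dec < δ_B < 2δ_extra` at GKS's printed value of `δ_extra` -/

/-- `2δ_extra = 3δ_dec − 2δ` at GKS's value `δ_extra = (3δ_dec − 2δ)/2` (companion `deltaExtraGKS` with `δ_h = δ_dec`).
[cite: GiorgiKlainermanSzeftel2022, Theorem M1 ch. 11 Step 7, TeX l.22524; refereed GiorgiKlainermanSzeftel2024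
(PAMQ 20 (2024) no. 7), HAL hal-05348127 p.532] -/
theorem two_deltaExtraGKS (δdec δ : ℝ) : 2 * deltaExtraGKS δdec δ = 3 * δdec - 2 * δ := by
  unfold deltaExtraGKS; ring

/-- GKS's "`δ_extra > δ_dec`" holds iff `δ < δ_dec/2` (strict), whereas GKS prints the choice "`2δ ≤ δ_dec`".
[cite: GiorgiKlainermanSzeftel2022, TeX l.22524 ("> δ_dec") and l.24524 ("2δ ≤ δ_dec")] -/
theorem deltaExtraGKS_gt_iff (δdec δ : ℝ) : δdec < deltaExtraGKS δdec δ ↔ δ < δdec / 2 := by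
  unfold deltaExtraGKS; constructor <;> intro h <;> linarith

/-- THE WINDOW: a `δ_B` with `2δ_dec < δ_B` (printed, KS (3.4.4)) AND `δ_B < 2δ_extra` (needed by zone II at the M1 profile) exists
iff `δ < δ_dec/2`.  [cite: KlainermanSzeftel2021, (3.4.4) TeX l.6076–6081; GiorgiKlainermanSzeftel2022, TeX l.22524] -/
theorem window_nonempty_iff (δdec δ : ℝ) :
    (∃ δB : ℝ, 2 * δdec < δB ∧ δB < 2 * deltaExtraGKS δdec δ) ↔ δ < δdec / 2 := by
  rw [two_deltaExtraGKS]
  constructor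
  · rintro ⟨δB, h1, h2⟩; linarith
  · intro h; exact ⟨(5 * δdec - 2 * δ) / 2, by linarith, by linarith⟩

/-- … in particular at the endpoint `δ = δ_dec/2` of GKS's printed range `2δ ≤ δ_dec` the window is EMPTY (and `δ_extra = δ_dec`).
[cite: GiorgiKlainermanSzeftel2022, TeX l.24524, l.22524] -/
theorem window_empty_at_endpoint (δdec : ℝ) :
    (¬ ∃ δB : ℝ, 2 * δdec < δB ∧ δB < 2 * deltaExtraGKS δdec (δdec / 2)) ∧ deltaExtraGKS δdec (δdec / 2) = δdec := by
  refine ⟨fun h => ?_, by unfold deltaExtraGKS; ring⟩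
  rw [window_nonempty_iff] at h
  linarith

/-- Inside the window both near zones close at the M1 profile `δ_X = δ_extra`: zone II by definition of the window, zone I because
`δ_B < 2δ_extra` implies `δ_B < 4δ_extra` once `δ_extra ≥ 0` (i.e. `δ ≤ 3δ_dec/2`).
[cite: KlainermanSzeftel2021, Theorem M1 item 2 TeX l.6684–6687; GiorgiKlainermanSzeftel2022, TeX l.22524] -/
theorem uExpI_of_window {δB δdec δ : ℝ} (hδ : δ ≤ 3 * δdec / 2) (hw : δB < 2 * deltaExtraGKS δdec δ) :
    uExpII δB (deltaExtraGKS δdec δ) < -1 ∧ uExpI δB (deltaExtraGKS δdec δ) < -1 := by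
  have he : 0 ≤ deltaExtraGKS δdec δ := by unfold deltaExtraGKS; linarith
  refine ⟨(uExpII_lt_iff _ _).2 hw, (uExpI_lt_iff _ _).2 (by linarith)⟩

/-- For the record, with the PRINTED near rate `δ_X = δ_dec` zone I would need `δ_B < 4δ_dec`, which the window implies
(`2δ_extra = 3δ_dec − 2δ ≤ 3δ_dec < 4δ_dec` for `δ ≥ 0`, `δ_dec > 0`).  [cite: KlainermanSzeftel2021, (3.4.4) TeX l.6076–6081] -/
theorem zoneI_printed_of_window {δB δdec δ : ℝ} (hdec : 0 < δdec) (hδ : 0 ≤ δ) (hw : δB < 2 * deltaExtraGKS δdec δ) :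
    uExpI δB δdec < -1 := by
  rw [two_deltaExtraGKS] at hw
  rw [uExpI_lt_iff]; linarith

/-- Summary of the closing conditions for the `(A,B)` `r^{3+δ_B}`-bulk at the M1 profile (`A`: Theorem M1 item 2; `B`: the
unlocated registry leaf KS9.4.13-Brate): far zone `r ≥ u` margin `1 + 2δ_extra − δ_B` (companion `marginA_M1`/`marginB_rateM1`),
near zone II `δ_B < 2δ_extra`, near zone I `δ_B < 4δ_extra`; the binding one is zone II, and together with the printed
`δ_B > 2δ_dec` it is satisfiable iff `δ < δ_dec/2`.  [cite: KlainermanSzeftel2021, TeX l.6684–6687, l.6076–6081, l.24420–24425;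
GiorgiKlainermanSzeftel2022, TeX l.22524] -/
theorem closing_conditions {δB δdec δ : ℝ} (hdec : 0 < δdec) (h344 : 2 * δdec < δB)
    (hw : δB < 2 * deltaExtraGKS δdec δ) :
    0 < margin (wAB δB) (rateA_M1 (deltaExtraGKS δdec δ)) ∧ uExpII δB (deltaExtraGKS δdec δ) < -1 ∧
      uExpI δB (deltaExtraGKS δdec δ) < -1 ∧ δ < δdec / 2 := by
  have hwin : δ < δdec / 2 := (window_nonempty_iff δdec δ).1 ⟨δB, h344, hw⟩
  have hδ' : δ ≤ 3 * δdec / 2 := by linarith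
  obtain ⟨h2, h1⟩ := uExpI_of_window hδ' hw
  refine ⟨?_, h2, h1, hwin⟩
  rw [marginA_M1]
  have : 2 * deltaExtraGKS δdec δ = 3 * δdec - 2 * δ := two_deltaExtraGKS δdec δ
  linarith

/-! ## §4 The slice functional of §9.4.8 is uniform in `u_*` with a power loss -/

/-- `u_*`-exponent of the `(A,B)` term of the slice functional `L_*²(k)` at `u = u₁ ≤ u_*` from the printed inputs: radial factor
`R^{δ_B}` with `R = δ_* ε₀^{-1} u_*^{1+δ_dec}` (companion `rstar_pow`: `u_*^{(1+δ_dec)δ_B}`) times `u₁^{-1-2δ_dec} ≤ 1`; we record the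
worst case `u₁ ≍ u_*`: `(1+δ_dec)δ_B − 1 − 2δ_dec`.  [cite: KlainermanSzeftel2021, (9.4.34)–(9.4.35) TeX l.24452–24461; r_* l.6103–6106] -/
def sliceExp (δB δdec : ℝ) : ℝ := (1 + δdec) * δB - 1 - 2 * δdec

/-- … which is NEGATIVE (indeed `< −δ_dec`) for `δ_B < 1`, `δ_dec ≥ 0` (KS (3.4.4): all `δ`'s `≪ 1`): on the slice `u₁ = u_*'` of
(9.2.7) (`u_*' ≍ u_*`, so `u₁^{-1-2δ_dec} ≍ u_*^{-1-2δ_dec}`) the `(A,B)` term of the slice functional is bounded uniformly in `u_*` by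
`≍ ε₀^{2−δ_B} δ_*^{δ_B}/δ_B` — a power loss in `ε₀`, no divergence (for a slice at bounded `u₁` only the non-uniform bound
`ε₀^{2−δ_B} δ_*^{δ_B} u_*^{(1+δ_dec)δ_B}/δ_B` results).  [cite: KlainermanSzeftel2021, (3.4.4) TeX l.6076–6081; (9.2.7); (9.4.34)–(9.4.35) l.24452–24461] -/
theorem sliceExp_neg {δB δdec : ℝ} (hB : δB < 1) (hdec : 0 ≤ δdec) :
    sliceExp δB δdec < -δdec ∧ sliceExp δB δdec < 0 := by
  unfold sliceExp
  have h1 : (1 + δdec) * δB ≤ (1 + δdec) * 1 := by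
    apply mul_le_mul_of_nonneg_left hB.le; linarith
  have h2 : (1 + δdec) * δB < 1 + δdec := by
    have := mul_lt_mul_of_pos_left hB (show (0:ℝ) < 1 + δdec by linarith)
    simpa using this
  constructor <;> linarith

/-- The power of `ε₀` in front of the slice functional: `ε₀² · ε₀^{-δ_B} = ε₀^{2−δ_B}` (`< ε₀²`-strength: for `0 < ε₀ < 1`, `δ_B > 0`
one has `ε₀² < ε₀^{2−δ_B}`).  [folklore] -/
theorem eps_power_loss {ε₀ δB : ℝ} (hε : 0 < ε₀) (hε1 : ε₀ < 1) (hδB : 0 < δB) :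
    ε₀ ^ (2:ℝ) * ε₀ ^ (-δB) = ε₀ ^ (2 - δB) ∧ ε₀ ^ (2:ℝ) < ε₀ ^ (2 - δB) := by
  refine ⟨by rw [← rpow_add hε]; ring_nf, ?_⟩
  exact rpow_lt_rpow_of_exponent_gt hε hε1 (by linarith)

end Literature.Geometry.Lorentzian.KlainermanSzeftel2021.NearZoneCount

end
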